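import Mathlib

/-!
# COSET WINDOW RIGIDITY, file 1: analytic lemmas — crux stmt-Schanuel-0969
`RigidCore.MinimalCounterexampleInAcl`

Line `kernel-arithmetic-selection`, helper file for the registered stub `stub_windowRigidity_coset`
(gen 14 coset window rigidity; file 2 `…WindowRigidityCoset.lean` assembles the theorem),
`--supports stmt-Schanuel-0969`.  Mathlib only.  Contents:

* Part A — iterated Rolle and the MEAN VALUE THEOREM FOR DIVIDED DIFFERENCES (real), via
  `Lagrange.interpolate` / `Lagrange.eval_iterate_derivative_eq_sum`;
* Part B — bookkeeping: real/imaginary parts of complex curves, the polar form of a real power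
  `u ^ y = ‖u‖ ^ y · e^{iy arg u}`, preconnectedness of the punctured disc, the lattice step;
* Part C — the meromorphic derivative chain: `F₀ = t ^ p · M`, `F_{k+1} = α (t F_k' + (ke-p) F_k)`,
  `M_k = F_k · t^{ke-p}`, `α t^{e+1} M_k' = M_{k+1}`, and along the principal root curve
  `s(σ) = (c + βσ)^{-1/e}` (`s' = (-β/e) s^{e+1}`) the chain rule `d/dσ M_k (s σ) = M_{k+1} (s σ)`;
* Part D — the degenerate case: `F_n ≡ 0` near `0` forces `M = Q((t^e)⁻¹)` near `0`
  (downward integration of the chain on the punctured disc).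

## References

* [folklore] mean value theorem for divided differences; Laurent/Puiseux bookkeeping.
-/

noncomputable section

set_option linter.dupNamespace false

open Filter Topology Polynomial

namespace Summit.Schanuel.Schanuel.Cruxes.MinimalCounterexampleInAcl.KernelArithmeticSelection

/-! ## Part A.  Iterated Rolle and the mean value theorem for divided differences (real) -/

/-- Iterated Rolle: if `r 0, r 1, …` is a derivative chain on `[lo, hi]` and `r k` has `m + 1`
strictly increasing zeros in `[lo, hi]` with `k + m = n`, then `r n` vanishes somewhere in
`[lo, hi]`. [folklore] -/
theorem coset_rolle_iterate {lo hi : ℝ} (r : ℕ → ℝ → ℝ) (n : ℕ)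
    (hder : ∀ k < n, ∀ x ∈ Set.Icc lo hi, HasDerivAt (r k) (r (k + 1) x) x) :
    ∀ m k : ℕ, k + m = n → ∀ x : Fin (m + 1) → ℝ, StrictMono x →
      (∀ i, x i ∈ Set.Icc lo hi) → (∀ i, r k (x i) = 0) → ∃ ξ ∈ Set.Icc lo hi, r n ξ = 0 := by
  intro m
  induction m with
  | zero =>
    intro k hk x _ hxI hx0
    obtain rfl : k = n := by omega
    exact ⟨x 0, hxI 0, hx0 0⟩
  | succ m ih =>
    intro k hk x hx hxI hx0
    have hk' : k < n := by omega
    have gap : ∀ i : Fin (m + 1), ∃ y ∈ Set.Ioo (x i.castSucc) (x i.succ), r (k + 1) y = 0 := by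
      intro i
      have hlt : x i.castSucc < x i.succ := hx i.castSucc_lt_succ
      refine exists_hasDerivAt_eq_zero (f := r k) (f' := r (k + 1)) hlt ?_ ?_ ?_
      · intro y hy
        have hyI : y ∈ Set.Icc lo hi := ⟨(hxI _).1.trans hy.1, hy.2.trans (hxI _).2⟩
        exact (hder k hk' y hyI).continuousAt.continuousWithinAt
      · rw [hx0, hx0]
      · intro y hy
        have hyI : y ∈ Set.Icc lo hi := ⟨(hxI _).1.trans hy.1.le, hy.2.le.trans (hxI _).2⟩
        exact hder k hk' y hyI
    choose y hy hy0 using gap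
    refine ih (k + 1) (by omega) y ?_ ?_ hy0
    · refine Fin.strictMono_iff_lt_succ.2 fun i => ?_
      calc y i.castSucc < x i.castSucc.succ := (hy _).2
        _ = x i.succ.castSucc := by rw [Fin.succ_castSucc]
        _ < y i.succ := (hy _).1
    · exact fun i => ⟨(hxI _).1.trans (hy i).1.le, (hy i).2.le.trans (hxI _).2⟩

/-- **Mean value theorem for divided differences.**  If `f 0, f 1, …, f n` is a derivative
chain on `[lo, hi]` and `x₀ < ⋯ < xₙ` are nodes in `[lo, hi]`, the divided difference
`∑ⱼ f 0 (xⱼ) / ∏_{i ≠ j} (xⱼ - xᵢ)` equals `f n ξ / n!` for some `ξ ∈ [lo, hi]`. [folklore] -/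
theorem coset_dividedDiff_mvt : ∀ {n : ℕ} (f : ℕ → ℝ → ℝ) {lo hi : ℝ},
    (∀ k < n, ∀ x ∈ Set.Icc lo hi, HasDerivAt (f k) (f (k + 1) x) x) → ∀ (x : Fin (n + 1) → ℝ),
    StrictMono x → (∀ i, x i ∈ Set.Icc lo hi) → ∃ ξ ∈ Set.Icc lo hi,
    f n ξ = n.factorial * ∑ i, f 0 (x i) / ∏ j ∈ Finset.univ.erase i, (x i - x j) := by
  intro n f lo hi hder x hx hxI
  classical
  set q : ℝ[X] := Lagrange.interpolate Finset.univ x (fun i => f 0 (x i)) with hq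
  have hinj : Set.InjOn x (Finset.univ : Finset (Fin (n + 1))) := hx.injective.injOn
  have hdeg : q.degree < (Finset.univ : Finset (Fin (n + 1))).card :=
    Lagrange.degree_interpolate_lt _ hinj
  set r : ℕ → ℝ → ℝ := fun k y => f k y - (derivative^[k] q).eval y with hr
  have hrder : ∀ k < n, ∀ y ∈ Set.Icc lo hi, HasDerivAt (r k) (r (k + 1) y) y := by
    intro k hk y hy
    show HasDerivAt (fun y => f k y - (derivative^[k] q).eval y)
      (f (k + 1) y - (derivative^[k + 1] q).eval y) y
    rw [Function.iterate_succ_apply']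
    exact (hder k hk y hy).sub (Polynomial.hasDerivAt _ y)
  have hr0 : ∀ i, r 0 (x i) = 0 := by
    intro i
    simp only [hr, Function.iterate_zero, id]
    rw [hq, Lagrange.eval_interpolate_at_node _ hinj (Finset.mem_univ i), sub_self]
  obtain ⟨ξ, hξI, hξ⟩ := coset_rolle_iterate r n hrder n 0 (by simp) x hx hxI hr0
  refine ⟨ξ, hξI, ?_⟩
  have hn : n < (Finset.univ : Finset (Fin (n + 1))).card := by simp
  have key := Lagrange.eval_iterate_derivative_eq_sum hinj hdeg hn ξ
  have hξ' : f n ξ = (derivative^[n] q).eval ξ := by simpa [hr, sub_eq_zero] using hξ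
  rw [hξ', key]
  have hcard : (Finset.univ : Finset (Fin (n + 1))).card - (n + 1) = 0 := by simp
  simp only [hcard, Finset.powersetCard_zero, Finset.sum_singleton, Finset.prod_empty, mul_one]
  congr 1
  refine Finset.sum_congr rfl fun i _ => ?_
  rw [hq, Lagrange.eval_interpolate_at_node _ hinj (Finset.mem_univ i)]

/-! ## Part B.  Elementary complex bookkeeping -/

/-- The real part of a differentiable complex curve is differentiable. [folklore] -/
theorem coset_hasDerivAt_re {φ : ℝ → ℂ} {φ' : ℂ} {τ : ℝ} (h : HasDerivAt φ φ' τ) :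
    HasDerivAt (fun σ => (φ σ).re) φ'.re τ := by
  simpa [Function.comp_def] using Complex.reCLM.hasFDerivAt.comp_hasDerivAt τ h

/-- The imaginary part of a differentiable complex curve is differentiable. [folklore] -/
theorem coset_hasDerivAt_im {φ : ℝ → ℂ} {φ' : ℂ} {τ : ℝ} (h : HasDerivAt φ φ' τ) :
    HasDerivAt (fun σ => (φ σ).im) φ'.im τ := by
  simpa [Function.comp_def] using Complex.imCLM.hasFDerivAt.comp_hasDerivAt τ h

/-- Polar form of a real power: `u ^ y = ‖u‖ ^ y · exp (i y arg u)`. [folklore] -/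
theorem coset_cpow_polar {u : ℂ} (hu : u ≠ 0) (y : ℝ) :
    u ^ (y : ℂ) =
      ((‖u‖ ^ y : ℝ) : ℂ) * Complex.exp (((Complex.arg u * y : ℝ) : ℂ) * Complex.I) := by
  rw [Complex.cpow_def_of_ne_zero hu, Real.rpow_def_of_pos (norm_pos_iff.2 hu), Complex.ofReal_exp,
    ← Complex.exp_add]
  congr 1
  apply Complex.ext
  · simp [Complex.log_re]
  · simp [Complex.log_im]

/-- The punctured disc is preconnected (polar coordinates). [folklore] -/
theorem coset_puncturedBall_isPreconnected (r : ℝ) :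
    IsPreconnected (Metric.ball (0 : ℂ) r \ {0}) := by
  have hset : Metric.ball (0 : ℂ) r \ {0} =
      (fun q : ℝ × ℝ => (q.1 : ℂ) * Complex.exp ((q.2 : ℂ) * Complex.I)) ''
        (Set.Ioo 0 r ×ˢ Set.univ) := by
    ext z
    simp only [Set.mem_sdiff, Metric.mem_ball, dist_zero_right, Set.mem_singleton_iff,
      Set.mem_image, Set.mem_prod, Set.mem_Ioo, Set.mem_univ, and_true, Prod.exists]
    constructor
    · rintro ⟨hz, hz0⟩
      exact ⟨‖z‖, Complex.arg z, ⟨norm_pos_iff.2 hz0, hz⟩, Complex.norm_mul_exp_arg_mul_I z⟩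
    · rintro ⟨a, b, ⟨ha0, har⟩, rfl⟩
      refine ⟨?_, mul_ne_zero (Complex.ofReal_ne_zero.2 ha0.ne') (Complex.exp_ne_zero _)⟩
      rw [norm_mul, Complex.norm_exp_ofReal_mul_I, mul_one, Complex.norm_of_nonneg ha0.le]
      exact har
  rw [hset]
  refine (isPreconnected_Ioo.prod isPreconnected_univ).image _ ?_
  fun_prop

/-- The lattice step: with integer nodes `g` and integer values `L`, the divided difference
`∑ Lᵢ / ∏_{j≠i} (gᵢ - gⱼ)` times `W = ∏ᵢ ∏_{j ≠ i} (gᵢ - gⱼ) ≠ 0` is an integer. [folklore] -/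
theorem coset_lattice {n : ℕ} (g : Fin (n + 1) → ℤ) (hg : Function.Injective g) :
    (∏ i, ∏ j ∈ Finset.univ.erase i, (g i - g j)) ≠ 0 ∧
    ∀ L : Fin (n + 1) → ℤ, ∃ Z : ℤ,
      (∑ i, (L i : ℝ) / ∏ j ∈ Finset.univ.erase i, ((g i : ℝ) - g j)) *
        ((∏ i, ∏ j ∈ Finset.univ.erase i, (g i - g j) : ℤ) : ℝ) = Z := by
  classical
  set P : Fin (n + 1) → ℤ := fun i => ∏ j ∈ Finset.univ.erase i, (g i - g j) with hP
  have hP0 : ∀ i, P i ≠ 0 := fun i => Finset.prod_ne_zero_iff.2 fun j hj =>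
    sub_ne_zero.2 fun h => (Finset.mem_erase.1 hj).1 (hg h).symm
  have hPR : ∀ i, (∏ j ∈ Finset.univ.erase i, ((g i : ℝ) - g j)) = (P i : ℝ) := by
    intro i; simp [hP]
  refine ⟨Finset.prod_ne_zero_iff.2 fun i _ => hP0 i, fun L => ?_⟩
  refine ⟨∑ i, L i * ∏ j ∈ Finset.univ.erase i, P j, ?_⟩
  rw [Finset.sum_mul]
  push_cast
  refine Finset.sum_congr rfl fun i _ => ?_
  rw [hPR i, ← Finset.mul_prod_erase Finset.univ (fun j => (P j : ℝ)) (Finset.mem_univ i)]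
  have : (P i : ℝ) ≠ 0 := by exact_mod_cast hP0 i
  field_simp

/-! ## Part C.  The meromorphic derivative chain -/

/-- The numerators `F_k` (`F₀ = F`, `F_{k+1} = α (t F_k' + (ke - p) F_k)`) are analytic on the
disc where `F` is. [folklore] -/
theorem coset_Fk_analyticOnNhd {e p : ℕ} {α : ℂ} {ρ : ℝ} {F : ℂ → ℂ} {Fk : ℕ → ℂ → ℂ}
    (hF : AnalyticOnNhd ℂ F (Metric.ball 0 ρ)) (h0 : Fk 0 = F)
    (hs : ∀ k, Fk (k + 1) =
      fun t => α * (t * deriv (Fk k) t + (((k * e : ℕ) : ℂ) - p) * Fk k t)) :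
    ∀ k, AnalyticOnNhd ℂ (Fk k) (Metric.ball 0 ρ) := by
  intro k
  induction k with
  | zero => simpa [h0] using hF
  | succ k ih =>
    rw [hs k]
    intro t ht
    have h1 : AnalyticAt ℂ (deriv (Fk k)) t := ih.deriv t ht
    have h2 : AnalyticAt ℂ (Fk k) t := ih t ht
    exact analyticAt_const.mul ((analyticAt_id.mul h1).add (analyticAt_const.mul h2))

/-- The phases `M_k t = F_k t · t^{ke - p}` satisfy `α t^{e+1} M_k' = M_{k+1}` off the
origin. [folklore] -/
theorem coset_Mk_hasDerivAt {e p : ℕ} {α : ℂ} {ρ : ℝ} {F : ℂ → ℂ} {Fk Mk : ℕ → ℂ → ℂ}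
    (hF : AnalyticOnNhd ℂ F (Metric.ball 0 ρ)) (h0 : Fk 0 = F)
    (hs : ∀ k, Fk (k + 1) =
      fun t => α * (t * deriv (Fk k) t + (((k * e : ℕ) : ℂ) - p) * Fk k t))
    (hMk : ∀ k t, Mk k t = Fk k t * t ^ (((k * e : ℕ) : ℤ) - p))
    (k : ℕ) {t : ℂ} (ht : t ∈ Metric.ball 0 ρ) (ht0 : t ≠ 0) :
    ∃ D : ℂ, HasDerivAt (Mk k) D t ∧ α * t ^ (e + 1) * D = Mk (k + 1) t := by
  have hFa := coset_Fk_analyticOnNhd hF h0 hs k t ht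
  set m : ℤ := ((k * e : ℕ) : ℤ) - p with hm
  set m' : ℤ := (((k + 1) * e : ℕ) : ℤ) - p with hm'
  have hd1 : HasDerivAt (Fk k) (deriv (Fk k) t) t := hFa.differentiableAt.hasDerivAt
  have hd2 := hasDerivAt_zpow m t (Or.inl ht0)
  have hfun : Mk k = fun t => Fk k t * t ^ m := funext (hMk k)
  refine ⟨deriv (Fk k) t * t ^ m + Fk k t * ((m : ℂ) * t ^ (m - 1)), ?_, ?_⟩
  · rw [hfun]
    exact hd1.fun_mul hd2
  rw [hMk, hs k]
  have e1 : t ^ (e + 1) * t ^ m = t * t ^ m' := by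
    calc t ^ (e + 1) * t ^ m = t ^ ((e + 1 : ℕ) : ℤ) * t ^ m := by rw [zpow_natCast]
      _ = t ^ (((e + 1 : ℕ) : ℤ) + m) := (zpow_add₀ ht0 _ _).symm
      _ = t ^ ((1 : ℤ) + m') := by congr 1; push_cast [hm, hm']; ring
      _ = t * t ^ m' := by rw [zpow_add₀ ht0, zpow_one]
  have e2 : t ^ (e + 1) * t ^ (m - 1) = t ^ m' := by
    calc t ^ (e + 1) * t ^ (m - 1) = t ^ ((e + 1 : ℕ) : ℤ) * t ^ (m - 1) := by rw [zpow_natCast]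
      _ = t ^ (((e + 1 : ℕ) : ℤ) + (m - 1)) := (zpow_add₀ ht0 _ _).symm
      _ = t ^ m' := by congr 1; push_cast [hm, hm']; ring
  have e3 : ((m : ℤ) : ℂ) = ((k * e : ℕ) : ℂ) - p := by push_cast [hm]; ring
  simp only
  rw [← e3]
  linear_combination (α * deriv (Fk k) t) * e1 + (α * Fk k t * (m : ℂ)) * e2

/-- The principal root curve `σ ↦ (c + βσ)^{-1/e}` has derivative `(-β/e) · s^{e+1}` wherever
`c + βσ` lies in the slit plane. [folklore] -/
theorem coset_root_hasDerivAt {e : ℕ} (he : 0 < e) (c β : ℂ) {τ : ℝ}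
    (hslit : c + β * (τ : ℂ) ∈ Complex.slitPlane) :
    HasDerivAt (fun σ : ℝ => (c + β * (σ : ℂ)) ^ (-((e : ℂ)⁻¹)))
      ((-β / e) * ((c + β * (τ : ℂ)) ^ (-((e : ℂ)⁻¹))) ^ (e + 1)) τ := by
  have hu0 : c + β * (τ : ℂ) ≠ 0 := Complex.slitPlane_ne_zero hslit
  have he0 : (e : ℂ) ≠ 0 := by exact_mod_cast he.ne'
  have h1 : HasDerivAt (fun w : ℂ => c + β * w) β (τ : ℂ) := by
    simpa using ((hasDerivAt_id (τ : ℂ)).const_mul β).const_add c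
  have h2 := (h1.cpow_const (c := -((e : ℂ)⁻¹)) hslit).comp_ofReal
  convert h2 using 1
  have key : (c + β * (τ : ℂ)) ^ (-((e : ℂ)⁻¹) - 1) =
      ((c + β * (τ : ℂ)) ^ (-((e : ℂ)⁻¹))) ^ (e + 1) := by
    rw [Complex.cpow_sub _ _ hu0, Complex.cpow_one, pow_succ, ← Complex.cpow_nat_mul]
    have : (e : ℂ) * -((e : ℂ)⁻¹) = -1 := by field_simp
    rw [this, Complex.cpow_neg_one, div_eq_mul_inv, mul_comm]
  rw [key]
  field_simp

/-- Chain rule along the root curve: `d/dσ M_k (s σ) = M_{k+1} (s σ)` with `α = -β/e`.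
[folklore] -/
theorem coset_chain {e p : ℕ} {α β c : ℂ} {ρ : ℝ} {F : ℂ → ℂ} {Fk Mk : ℕ → ℂ → ℂ}
    (he : 0 < e) (hα : α = -β / e)
    (hF : AnalyticOnNhd ℂ F (Metric.ball 0 ρ)) (h0 : Fk 0 = F)
    (hs : ∀ k, Fk (k + 1) =
      fun t => α * (t * deriv (Fk k) t + (((k * e : ℕ) : ℂ) - p) * Fk k t))
    (hMk : ∀ k t, Mk k t = Fk k t * t ^ (((k * e : ℕ) : ℤ) - p))
    (k : ℕ) {τ : ℝ} (hslit : c + β * (τ : ℂ) ∈ Complex.slitPlane)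
    (hball : (c + β * (τ : ℂ)) ^ (-((e : ℂ)⁻¹)) ∈ Metric.ball (0 : ℂ) ρ) :
    HasDerivAt (fun σ : ℝ => Mk k ((c + β * (σ : ℂ)) ^ (-((e : ℂ)⁻¹))))
      (Mk (k + 1) ((c + β * (τ : ℂ)) ^ (-((e : ℂ)⁻¹)))) τ := by
  have hs0 : (c + β * (τ : ℂ)) ^ (-((e : ℂ)⁻¹)) ≠ 0 :=
    Complex.cpow_ne_zero_iff.2 (Or.inl (Complex.slitPlane_ne_zero hslit))
  obtain ⟨D, hD, hDeq⟩ := coset_Mk_hasDerivAt hF h0 hs hMk k hball hs0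
  have hroot := coset_root_hasDerivAt he c β hslit
  have hcomp := hD.comp τ hroot
  have hfun : (fun σ : ℝ => Mk k ((c + β * (σ : ℂ)) ^ (-((e : ℂ)⁻¹)))) =
      Mk k ∘ fun σ : ℝ => (c + β * (σ : ℂ)) ^ (-((e : ℂ)⁻¹)) := rfl
  rw [hfun]
  refine hcomp.congr_deriv ?_
  rw [← hDeq, hα]
  ring

/-- `M₀ = M` off the origin. [folklore] -/
theorem coset_Mk_zero {e p : ℕ} {M F : ℂ → ℂ} {Fk Mk : ℕ → ℂ → ℂ}
    (hFM : ∀ t, F t = t ^ p * M t) (h0 : Fk 0 = F)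
    (hMk : ∀ k t, Mk k t = Fk k t * t ^ (((k * e : ℕ) : ℤ) - p)) {t : ℂ} (ht : t ≠ 0) :
    Mk 0 t = M t := by
  rw [hMk, h0, hFM]
  simp only [zero_mul, Nat.cast_zero, zero_sub, zpow_neg, zpow_natCast]
  field_simp

/-! ## Part D.  The degenerate case: `F_n ≡ 0` near `0` forces `M = Q((t^e)⁻¹)` -/

/-- If the `n`-th numerator vanishes identically near `0`, then integrating the chain
`α t^{e+1} M_k' = M_{k+1}` downwards on the punctured disc shows that `M` is a polynomial in
`(t^e)⁻¹` near `0`. [folklore] -/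
theorem coset_degenerate {e p n : ℕ} {α : ℂ} {ρ : ℝ} {M F : ℂ → ℂ} {Fk Mk : ℕ → ℂ → ℂ}
    (he : 0 < e) (hα : α ≠ 0) (hρ : 0 < ρ)
    (hF : AnalyticOnNhd ℂ F (Metric.ball 0 ρ)) (hFM : ∀ t, F t = t ^ p * M t) (h0 : Fk 0 = F)
    (hs : ∀ k, Fk (k + 1) =
      fun t => α * (t * deriv (Fk k) t + (((k * e : ℕ) : ℂ) - p) * Fk k t))
    (hMk : ∀ k t, Mk k t = Fk k t * t ^ (((k * e : ℕ) : ℤ) - p))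
    (hzero : ∀ᶠ t in 𝓝 (0 : ℂ), Fk n t = 0) :
    ∃ Q : Polynomial ℂ, ∀ᶠ t in 𝓝[≠] (0 : ℂ), M t = Q.eval (t ^ e)⁻¹ := by
  obtain ⟨ρ₁, hρ₁, hρ₁z⟩ := Metric.eventually_nhds_iff_ball.1 hzero
  set ρ' : ℝ := min ρ ρ₁ with hρ'def
  have hρ' : 0 < ρ' := lt_min hρ hρ₁
  set U : Set ℂ := Metric.ball (0 : ℂ) ρ' \ {0} with hU
  have hUopen : IsOpen U := Metric.isOpen_ball.sdiff isClosed_singleton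
  have hUconn : IsPreconnected U := coset_puncturedBall_isPreconnected ρ'
  have hUρ : ∀ t ∈ U, t ∈ Metric.ball (0 : ℂ) ρ := fun t ht =>
    Metric.ball_subset_ball (min_le_left _ _) ht.1
  have hUρ₁ : ∀ t ∈ U, t ∈ Metric.ball (0 : ℂ) ρ₁ := fun t ht =>
    Metric.ball_subset_ball (min_le_right _ _) ht.1
  have hU0 : ∀ t ∈ U, t ≠ 0 := fun t ht => ht.2
  have claim : ∀ d, d ≤ n → ∃ (N : ℕ) (a : ℕ → ℂ), ∀ t ∈ U,
      Mk (n - d) t = ∑ q ∈ Finset.range N, a q * t ^ (-((q * e : ℕ) : ℤ)) := by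
    intro d
    induction d with
    | zero =>
      intro _
      refine ⟨0, fun _ => 0, fun t ht => ?_⟩
      simp [hMk, hρ₁z t (hUρ₁ t ht)]
    | succ d ih =>
      intro hd
      obtain ⟨N, a, ha⟩ := ih (by omega)
      have hj : n - d = (n - (d + 1)) + 1 := by omega
      set j := n - (d + 1) with hjdef
      rw [hj] at ha
      set b : ℕ → ℂ := fun q => a q / (α * (-(((q + 1) * e : ℕ) : ℂ))) with hb
      set A : ℂ → ℂ := fun t => ∑ q ∈ Finset.range N, b q * t ^ (-(((q + 1) * e : ℕ) : ℤ))
        with hA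
      have hqe : ∀ q : ℕ, (((q + 1) * e : ℕ) : ℂ) ≠ 0 := fun q =>
        Nat.cast_ne_zero.2 (Nat.mul_ne_zero (Nat.succ_ne_zero q) he.ne')
      have hcoef : ∀ q : ℕ, α * (-(((q + 1) * e : ℕ) : ℂ)) ≠ 0 := fun q =>
        mul_ne_zero hα (neg_ne_zero.2 (hqe q))
      have hAder : ∀ t ∈ U, HasDerivAt A (∑ q ∈ Finset.range N,
          b q * (((-(((q + 1) * e : ℕ) : ℤ) : ℤ) : ℂ) * t ^ (-(((q + 1) * e : ℕ) : ℤ) - 1))) t := by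
        intro t ht
        refine HasDerivAt.fun_sum fun q _ => ?_
        exact (hasDerivAt_zpow _ t (Or.inl (hU0 t ht))).const_mul (b q)
      have hMkdiff : DifferentiableOn ℂ (Mk j) U := fun t ht =>
        (coset_Mk_hasDerivAt hF h0 hs hMk j (hUρ t ht) (hU0 t ht)).choose_spec.1
          |>.differentiableAt.differentiableWithinAt
      have hAdiff : DifferentiableOn ℂ A U := fun t ht =>
        (hAder t ht).differentiableAt.differentiableWithinAt
      have hderiv : U.EqOn (deriv (Mk j)) (deriv A) := by
        intro t ht
        have ht0 := hU0 t ht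
        obtain ⟨D, hD, hDeq⟩ := coset_Mk_hasDerivAt hF h0 hs hMk j (hUρ t ht) ht0
        rw [hD.deriv, (hAder t ht).deriv]
        apply mul_left_cancel₀ (mul_ne_zero hα (pow_ne_zero (e + 1) ht0))
        rw [hDeq, ha t ht, Finset.mul_sum]
        refine Finset.sum_congr rfl fun q _ => ?_
        have hz : t ^ (e + 1) * t ^ (-(((q + 1) * e : ℕ) : ℤ) - 1) = t ^ (-((q * e : ℕ) : ℤ)) := by
          calc t ^ (e + 1) * t ^ (-(((q + 1) * e : ℕ) : ℤ) - 1)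
              = t ^ ((e + 1 : ℕ) : ℤ) * t ^ (-(((q + 1) * e : ℕ) : ℤ) - 1) := by
                rw [zpow_natCast]
            _ = t ^ (((e + 1 : ℕ) : ℤ) + (-(((q + 1) * e : ℕ) : ℤ) - 1)) :=
                (zpow_add₀ ht0 _ _).symm
            _ = t ^ (-((q * e : ℕ) : ℤ)) := by congr 1; push_cast; ring
        simp only [hb]
        have hγ0 := hqe q
        set γ : ℂ := (((q + 1) * e : ℕ) : ℂ) with hγ
        have hcast : ((-(((q + 1) * e : ℕ) : ℤ) : ℤ) : ℂ) = -γ := by rw [hγ]; push_cast; ring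
        rw [hcast, ← hz]
        field_simp
      obtain ⟨κ, hκ⟩ := hUopen.exists_eq_add_of_deriv_eq hUconn hMkdiff hAdiff hderiv
      refine ⟨N + 1, fun q => if q = 0 then κ else b (q - 1), fun t ht => ?_⟩
      rw [hκ ht, Finset.sum_range_succ']
      simp [hA, add_comm]
  obtain ⟨N, a, ha⟩ := claim n le_rfl
  rw [Nat.sub_self] at ha
  refine ⟨∑ q ∈ Finset.range N, Polynomial.C (a q) * Polynomial.X ^ q, ?_⟩
  have hUmem : U ∈ 𝓝[≠] (0 : ℂ) :=
    sdiff_mem_nhdsWithin_compl (Metric.ball_mem_nhds 0 hρ') {0}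
  filter_upwards [hUmem] with t ht
  rw [← coset_Mk_zero hFM h0 hMk (hU0 t ht), ha t ht, Polynomial.eval_finsetSum]
  refine Finset.sum_congr rfl fun q _ => ?_
  simp only [Polynomial.eval_mul, Polynomial.eval_C, Polynomial.eval_pow, Polynomial.eval_X]
  congr 1
  rw [zpow_neg, zpow_natCast, pow_mul', ← inv_pow]

end Summit.Schanuel.Schanuel.Cruxes.MinimalCounterexampleInAcl.KernelArithmeticSelection
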